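import Mathlib
import Literature.NumberTheory.LFunctions.Zhang2022.Section8cStatements
import Literature.NumberTheory.LFunctions.Zhang2022.SkeletonReductions
import HarnessLib

/-!
# Zhang (2022) §8 (8.11): the partial-summation tool and the calculus of the (8.11) profiles

Topic `Literature/NumberTheory/LFunctions/Zhang2022` (Landau–Siegel audit tree; verdict-neutral).
D-0069 campaign, cell `siegel-zhang`, DISCHARGE board row **D01** (`Skeleton.Ded823` chain), the
(8.11) edge `Section8cStatements.Ded811` ("it follows by partial integration that", [Z22 p.48,
tex L2466]) — INFRASTRUCTURE for its discharge (the assembly of `Ded811` itself is seat d16's;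
this file is seat sz-d29's half of the split). Y. Zhang, *Discrete mean estimates and the
Landau–Siegel zero*, arXiv:2211.02515v1 (2022) [Zhang2022LandauSiegel] — **an unrefereed manuscript
under adjudication; this file proves elementary real/complex-analysis lemmas about the manuscript's
own typed objects and asserts nothing about its Theorems 1–2 or about Landau–Siegel zeros.**
Theorem-only (no definitions, no new facts, no numerics).

| decl | content |
|---|---|
| `norm_sum_mul_sub_integral_le` | **Abel summation against a `c log t + O(K)` counting function**: `b(0)=0`, `|Σ_{k≤t} b(k) − c log t| ≤ K` on `[1,X]`, `F ∈ C¹[1,X]`, `‖F‖ ≤ M`, `‖F′(t)‖ ≤ M′/t` ⟹ `‖Σ_{k≤X} b(k)F(k) − c∫₁^X F(t)dt/t‖ ≤ K(M + M′ log X)` (Mathlib `sum_mul_eq_sub_integral_mul₀` + one integration by parts) |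
| `hasDerivAt_frakf`, `hasDerivAt_frakg` | `d/dL` of the Lemma 8.2 / 8.4 profiles `𝔣_{jμ}(L)`, `𝔤_{jμ}(L)` (closed forms) |
| `norm_frakf_le`, `norm_frakg_le` | `‖𝔣‖ ≤ 29`, `‖𝔣′‖ ≤ 94a`; `‖𝔤‖ ≤ 146`, `‖𝔤′‖ ≤ 449a` for shifts `‖β_j‖ ≤ 4a`, `3a/2 ≤ ‖β_μ‖ ≤ 3a`, `β_μ ∈ iℝ`, `a|L| ≤ 4` |
| `hasDerivAt_ofReal_log_div`, `hasDerivAt_comp_log_div`, `abs_log_div_le` | `d/dt g(log(Q/t)) = −g′(log(Q/t))/t`; `|log(Q/t)| ≤ log T` on `[1,T]²` |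
| `norm_betaJ_le`, `betaMu_re`, `norm_betaMu_bounds` | `‖β_j‖ ≤ 4α` once `5|c′|α𝓛 ≤ 1` ((2.13)); `β_μ ∈ iℝ`, `3α/2 ≤ ‖β_μ‖ ≤ 3α` ((2.22)) |
| `frakfW_div_bounds`, `frakgW_div_bounds` | `t ↦ 𝓕_{jμ}(Q/t)`, `𝓖_{jμ}(Q/t)` on `[1,T]`: differentiable, `O(1)`, derivative `O(α/t)` |
| `mul_bounds` | product rule with `O(1)`, `O(1/t)` bounds |
| `mFac_bounds`, `nFac_bounds`, `diagFac_bounds` | the three factors of (8.11) (`Section8cStatements.mFac/nFac/diagFac`) on `[1,T]` ⊇ `[1,P₁+1]`: differentiable, `‖mFac‖ ≤ 29κ`, `‖mFac′‖ ≤ 94ακ/t`, `‖nFac‖ ≤ 146κ`, `‖nFac′‖ ≤ 449ακ/t` (`κ = 1/log P₁ + ‖ι₂‖/log P₂`), `‖diagFac‖ ≤ 4234/(log P₁)²`, `‖diagFac′‖ ≤ 26745α/((log P₁)²t)` |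

These are exactly the hypotheses `hFd`, `hF`, `hF'` of `norm_sum_mul_sub_integral_le` for
`F = mFac·nFac` (range `1 ≤ n < P₂`) and `F = diagFac` (range `P₂ ≤ n < P₁`), with
`M ≍ 𝓛⁻¹⁸`, `M′ ≍ α𝓛⁻¹⁸`; the same tool serves §9's "in a way similar to the proof of (8.12)"
[Z22 p.51] and §10. WHAT THIS FILE IS NOT: the discharge of `Ded811` (the weights
`λ₀ⱼ(n)/φ(n) ↦ φ(n)/n²`, the counting function of `Step8u048`, the range bookkeeping and the
identification `c_D·L′(1,χ)² = 𝔞` are assembled elsewhere), nor any claim about Theorems 1–2.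

## References

* Y. Zhang, arXiv:2211.02515v1 (2022), §8 (8.11) p.48; Lemmas 8.2, 8.4 pp.45–46; §2 (2.13),
  (2.21), (2.22). [cite: Zhang2022LandauSiegel, §8 (8.11) p.48]
-/

noncomputable section

open Complex Real ComplexConjugate Set MeasureTheory Finset

namespace Literature.NumberTheory.LFunctions.Zhang2022.Section8AbelProfiles

open Skeleton Section8cStatements

/-! ### Abel summation against `c_D log x + O(K)` -/

/-- **Partial summation against a counting function `C(t) = c·log t + O(K)`.** If real weights
`b(k)` (`b(0) = 0`) have summatory function `Σ_{k ≤ t} b(k) = c log t + R(t)` with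
`|R(t)| ≤ K` on `[1, X]`, and `F ∈ C¹[1, X]` (complex-valued) satisfies `‖F‖ ≤ M`, `‖F′(t)‖ ≤ M′/t`
there, then `|Σ_{k ≤ X} b(k)F(k) − c∫₁^X F(t)dt/t| ≤ K(M + M′ log X)` (Abel summation, Mathlib's
`sum_mul_eq_sub_integral_mul₀`, plus one integration by parts). This is the "partial integration"
of [Z22 p.48, tex L2466]. [cite: Zhang2022LandauSiegel, §8 (8.11) p.48] -/
theorem norm_sum_mul_sub_integral_le {b : ℕ → ℝ} (hb0 : b 0 = 0) {F : ℝ → ℂ}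
    {X c K M M' : ℝ} (hX : 1 ≤ X) (hM' : 0 ≤ M')
    (hR : ∀ t ∈ Set.Icc 1 X, |(∑ k ∈ Finset.Icc 0 ⌊t⌋₊, b k) - c * Real.log t| ≤ K)
    (hFd : ∀ t ∈ Set.Icc 1 X, DifferentiableAt ℝ F t)
    (hF : ∀ t ∈ Set.Icc 1 X, ‖F t‖ ≤ M) (hF' : ∀ t ∈ Set.Icc 1 X, ‖deriv F t‖ ≤ M' / t) :
    ‖(∑ k ∈ Finset.Icc 0 ⌊X⌋₊, F k * (b k : ℂ)) - c * ∫ t in (1 : ℝ)..X, F t / t‖ ≤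
      K * M + K * M' * Real.log X := by
  -- Abel summation
  set cc : ℕ → ℂ := fun k => (b k : ℂ) with hcc
  have hcc0 : cc 0 = 0 := by simp [hcc, hb0]
  set F' : ℝ → ℂ := deriv F with hF'def
  have hFd' : ∀ t ∈ Set.Icc 1 X, HasDerivAt F (F' t) t := fun t ht => (hFd t ht).hasDerivAt
  -- `F′` is integrable on `[1, X]`: measurable (as a derivative) and bounded by `M′`
  have hmeas : AEStronglyMeasurable F' volume :=
    (measurable_deriv F).aestronglyMeasurable
  have hbd : ∀ᵐ t ∂(volume.restrict (Set.Icc 1 X)), ‖F' t‖ ≤ M' := by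
    rw [ae_restrict_iff' measurableSet_Icc]
    exact ae_of_all _ fun t ht => (hF' t ht).trans (div_le_self hM' ht.1)
  have hint : IntegrableOn F' (Set.Icc 1 X) :=
    Measure.integrableOn_of_bounded measure_Icc_lt_top.ne hmeas hbd
  have abel := sum_mul_eq_sub_integral_mul₀ cc hcc0 X hFd hint
  -- the counting function and its remainder
  set C : ℝ → ℂ := fun t => ∑ k ∈ Finset.Icc 0 ⌊t⌋₊, cc k with hC
  have hCreal : ∀ t, C t = ((∑ k ∈ Finset.Icc 0 ⌊t⌋₊, b k : ℝ) : ℂ) := by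
    intro t; simp [hC, hcc]
  have hRC : ∀ t ∈ Set.Icc 1 X, ‖C t - c * Real.log t‖ ≤ K := by
    intro t ht
    rw [hCreal, ← Complex.ofReal_mul, ← Complex.ofReal_sub, Complex.norm_real, Real.norm_eq_abs]
    exact hR t ht
  -- integrability facts
  have hF'C : IntervalIntegrable (fun t => F' t * C t) volume 1 X := by
    rw [intervalIntegrable_iff_integrableOn_Icc_of_le hX]
    exact integrableOn_mul_sum_Icc cc zero_le_one hint
  have hlogc : ContinuousOn (fun t : ℝ => (c : ℂ) * (Real.log t : ℂ)) (Set.Icc 1 X) :=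
    continuousOn_const.mul (Complex.continuous_ofReal.comp_continuousOn
      (Real.continuousOn_log.mono fun t ht => by
        simp only [Set.mem_compl_iff, Set.mem_singleton_iff]; exact (by linarith [ht.1] : t ≠ 0)))
  have hF'log : IntervalIntegrable (fun t => F' t * ((c : ℂ) * (Real.log t : ℂ))) volume 1 X := by
    rw [intervalIntegrable_iff_integrableOn_Icc_of_le hX]
    exact hint.mul_continuousOn hlogc isCompact_Icc
  have hinvc : ContinuousOn (fun t : ℝ => ((c : ℂ) / (t : ℂ))) (Set.Icc 1 X) :=
    continuousOn_const.div (Complex.continuous_ofReal.continuousOn)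
      (fun t ht => by exact_mod_cast (by linarith [ht.1] : t ≠ 0))
  -- integration by parts: `c ∫₁^X F/t = F(X) c log X − ∫₁^X F′ · c log`
  have hlogd : ∀ t ∈ Set.uIcc 1 X, HasDerivAt (fun t : ℝ => (c : ℂ) * (Real.log t : ℂ))
      ((c : ℂ) / (t : ℂ)) t := by
    intro t ht
    rw [Set.uIcc_of_le hX] at ht
    have ht0 : t ≠ 0 := by linarith [ht.1]
    have h1 : HasDerivAt (fun t : ℝ => (Real.log t : ℂ)) ((t⁻¹ : ℝ) : ℂ) t :=
      (Real.hasDerivAt_log ht0).ofReal_comp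
    have h2 := h1.const_mul (c : ℂ)
    refine h2.congr_deriv ?_
    push_cast
    rw [div_eq_mul_inv]
  have ibp := intervalIntegral.integral_mul_deriv_eq_deriv_mul
    (fun t ht => hFd' t (by rwa [Set.uIcc_of_le hX] at ht)) hlogd
    ((intervalIntegrable_iff_integrableOn_Icc_of_le hX).mpr hint) (hinvc.intervalIntegrable_of_Icc hX)
  -- `ibp : ∫₁^X F t * (c/t) = F X * (c log X) − F 1 * (c log 1) − ∫₁^X F′ t * (c log t)`
  have eI : (c : ℂ) * ∫ t in (1 : ℝ)..X, F t / t = ∫ t in (1 : ℝ)..X, F t * ((c : ℂ) / (t : ℂ)) := by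
    rw [← intervalIntegral.integral_const_mul]
    congr 1; funext t; ring
  -- convert Abel's set integral into an interval integral
  have eA : ∫ t in Set.Ioc 1 X, deriv F t * C t = ∫ t in (1 : ℝ)..X, F' t * C t := by
    rw [intervalIntegral.integral_of_le hX]
  -- assemble
  have key : (∑ k ∈ Finset.Icc 0 ⌊X⌋₊, F k * (b k : ℂ)) - c * ∫ t in (1 : ℝ)..X, F t / t =
      F X * (C X - c * Real.log X) - ∫ t in (1 : ℝ)..X, F' t * (C t - c * Real.log t) := by
    have e1 : (∑ k ∈ Finset.Icc 0 ⌊X⌋₊, F k * (b k : ℂ)) = F X * C X - ∫ t in (1 : ℝ)..X, F' t * C t := by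
      rw [← eA]; exact abel
    rw [e1, eI, ibp, Real.log_one]
    have e2 : ∫ t in (1 : ℝ)..X, F' t * (C t - c * Real.log t) =
        (∫ t in (1 : ℝ)..X, F' t * C t) - ∫ t in (1 : ℝ)..X, F' t * ((c : ℂ) * (Real.log t : ℂ)) := by
      rw [← intervalIntegral.integral_sub hF'C hF'log]
      congr 1; funext t; ring
    rw [e2]
    push_cast
    ring
  rw [key]
  have hXmem : X ∈ Set.Icc 1 X := ⟨hX, le_rfl⟩
  have n1 : ‖F X * (C X - c * Real.log X)‖ ≤ M * K := by
    rw [norm_mul]; exact mul_le_mul (hF X hXmem) (hRC X hXmem) (norm_nonneg _) ((norm_nonneg _).trans (hF X hXmem))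
  have n2 : ‖∫ t in (1 : ℝ)..X, F' t * (C t - c * Real.log t)‖ ≤ ∫ t in (1 : ℝ)..X, M' * K / t := by
    refine intervalIntegral.norm_integral_le_of_norm_le hX ?_ ?_
    · filter_upwards with t ht
      have ht' : t ∈ Set.Icc 1 X := ⟨ht.1.le, ht.2⟩
      have ht0 : 0 < t := by linarith [ht.1]
      rw [norm_mul]
      calc ‖F' t‖ * ‖C t - c * Real.log t‖ ≤ M' / t * K :=
            mul_le_mul (hF' t ht') (hRC t ht') (norm_nonneg _) (by positivity)
        _ = M' * K / t := by ring
    · exact (continuousOn_const.div continuousOn_id fun t ht => by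
        rw [Set.uIcc_of_le hX] at ht; exact (by linarith [ht.1] : t ≠ 0)).intervalIntegrable
  have n3 : ∫ t in (1 : ℝ)..X, M' * K / t = M' * K * Real.log X := by
    have e : (fun t : ℝ => M' * K / t) = fun t => M' * K * t⁻¹ := by funext t; ring
    rw [e, intervalIntegral.integral_const_mul, integral_inv (by
      rw [Set.uIcc_of_le hX]; intro h; exact absurd h.1 (by norm_num)), div_one]
  calc ‖F X * (C X - c * Real.log X) - ∫ t in (1 : ℝ)..X, F' t * (C t - c * Real.log t)‖
      ≤ ‖F X * (C X - c * Real.log X)‖ + ‖∫ t in (1 : ℝ)..X, F' t * (C t - c * Real.log t)‖ :=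
        norm_sub_le _ _
    _ ≤ M * K + M' * K * Real.log X := add_le_add n1 (n2.trans n3.le)
    _ = K * M + K * M' * Real.log X := by ring

/-! ### Calculus of the profiles `𝔣_{jμ}`, `𝔤_{jμ}` (Lemmas 8.2/8.4) in the variable `L = log x` -/

/-- `d/dL 𝔣_{jμ} = e^{β_μL}((β_μ − β_j) + (1 + (β_μ − β_j)L)β_μ)`. [cite: Zhang2022LandauSiegel, §8 Lemma 8.2] -/
theorem hasDerivAt_frakf (βj βμ L : ℂ) :
    HasDerivAt (fun L => frakf βj βμ L)
      (cexp (βμ * L) * ((βμ - βj) + (1 + (βμ - βj) * L) * βμ)) L := by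
  have h1 : HasDerivAt (fun L : ℂ => 1 + (βμ - βj) * L) (βμ - βj) L := by
    simpa using ((hasDerivAt_id L).const_mul (βμ - βj)).const_add 1
  have h2 : HasDerivAt (fun L : ℂ => cexp (βμ * L)) (cexp (βμ * L) * βμ) L := by
    simpa using ((hasDerivAt_id L).const_mul βμ).cexp
  have h := h1.mul h2
  refine (h.congr_of_eventuallyEq ?_).congr_deriv (by ring)
  exact Filter.Eventually.of_forall fun x => by simp [frakf]

/-- `d/dL 𝔤_{jμ} = e^{−β_μL}(−E − (1 − A − EL)β_μ)`, `A = β_{j+1}β_{j+2}/β_μ²`,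
`E = (β_{j+1} − β_μ)(β_{j+2} − β_μ)/β_μ`. [cite: Zhang2022LandauSiegel, §8 Lemma 8.4] -/
theorem hasDerivAt_frakg (β1 β2 βμ L : ℂ) :
    HasDerivAt (fun L => frakg β1 β2 βμ L)
      (cexp (-(βμ * L)) * (-((β1 - βμ) * (β2 - βμ) / βμ) -
        (1 - β1 * β2 / βμ ^ 2 - (β1 - βμ) * (β2 - βμ) / βμ * L) * βμ)) L := by
  have h1 : HasDerivAt (fun L : ℂ => 1 - β1 * β2 / βμ ^ 2 - (β1 - βμ) * (β2 - βμ) / βμ * L)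
      (-((β1 - βμ) * (β2 - βμ) / βμ)) L := by
    have := ((hasDerivAt_id L).const_mul ((β1 - βμ) * (β2 - βμ) / βμ)).const_sub
      (1 - β1 * β2 / βμ ^ 2)
    simpa using this
  have h2 : HasDerivAt (fun L : ℂ => cexp (-(βμ * L))) (cexp (-(βμ * L)) * (-βμ)) L := by
    have := (((hasDerivAt_id L).const_mul βμ).neg).cexp
    simpa using this
  have h := (h1.mul h2).const_add (β1 * β2 / βμ ^ 2)
  refine (h.congr_of_eventuallyEq ?_).congr_deriv (by ring)
  exact Filter.Eventually.of_forall fun x => by simp [frakg]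

/-- `|e^{βL}| = 1` for `β` purely imaginary and `L` real. [cite: Zhang2022LandauSiegel, §2 (2.22)] -/
theorem norm_cexp_mul_ofReal_of_re_eq_zero {β : ℂ} (hβ : β.re = 0) (L : ℝ) :
    ‖cexp (β * L)‖ = 1 := by
  rw [Complex.norm_exp]; simp [Complex.mul_re, hβ]

/-- `|e^{−βL}| = 1` for `β` purely imaginary and `L` real. [cite: Zhang2022LandauSiegel, §2 (2.22)] -/
theorem norm_cexp_neg_mul_ofReal_of_re_eq_zero {β : ℂ} (hβ : β.re = 0) (L : ℝ) :
    ‖cexp (-(β * L))‖ = 1 := by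
  rw [Complex.norm_exp]; simp [Complex.mul_re, hβ]

/-- **Size of `𝔣_{jμ}` and of its `L`-derivative.** For `β_μ` purely imaginary with `‖β_μ‖ ≤ 3a`,
`‖β_j‖ ≤ 4a` and `a|L| ≤ 4`: `‖𝔣_{jμ}(L)‖ ≤ 29` and `‖𝔣′_{jμ}(L)‖ ≤ 94a`.
[cite: Zhang2022LandauSiegel, §8 Lemma 8.2] -/
theorem norm_frakf_le {βj βμ : ℂ} {a L : ℝ} (hμre : βμ.re = 0) (hμ : ‖βμ‖ ≤ 3 * a)
    (hj : ‖βj‖ ≤ 4 * a) (hL : a * |L| ≤ 4) :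
    ‖frakf βj βμ L‖ ≤ 29 ∧
      ‖cexp (βμ * L) * ((βμ - βj) + (1 + (βμ - βj) * L) * βμ)‖ ≤ 94 * a := by
  have hδ : ‖βμ - βj‖ ≤ 7 * a := (norm_sub_le _ _).trans (by linarith)
  have hL' : ‖(L : ℂ)‖ = |L| := by rw [Complex.norm_real, Real.norm_eq_abs]
  have h1 : ‖1 + (βμ - βj) * (L : ℂ)‖ ≤ 29 := by
    calc ‖1 + (βμ - βj) * (L : ℂ)‖ ≤ ‖(1 : ℂ)‖ + ‖(βμ - βj) * (L : ℂ)‖ := norm_add_le _ _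
      _ = 1 + ‖βμ - βj‖ * |L| := by rw [norm_one, norm_mul, hL']
      _ ≤ 1 + 7 * a * |L| := by gcongr
      _ ≤ 29 := by nlinarith [abs_nonneg L]
  refine ⟨?_, ?_⟩
  · rw [frakf, norm_mul, norm_cexp_mul_ofReal_of_re_eq_zero hμre, mul_one]; exact h1
  · rw [norm_mul, norm_cexp_mul_ofReal_of_re_eq_zero hμre, one_mul]
    calc ‖(βμ - βj) + (1 + (βμ - βj) * (L : ℂ)) * βμ‖
        ≤ ‖βμ - βj‖ + ‖(1 + (βμ - βj) * (L : ℂ)) * βμ‖ := norm_add_le _ _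
      _ = ‖βμ - βj‖ + ‖1 + (βμ - βj) * (L : ℂ)‖ * ‖βμ‖ := by rw [norm_mul]
      _ ≤ 7 * a + 29 * (3 * a) := by gcongr
      _ = 94 * a := by ring

/-- **Size of `𝔤_{jμ}` and of its `L`-derivative.** For `β_μ` purely imaginary with
`3a/2 ≤ ‖β_μ‖ ≤ 3a` (`a > 0`), `‖β_{j+1}‖, ‖β_{j+2}‖ ≤ 4a` and `a|L| ≤ 4`: `‖𝔤_{jμ}(L)‖ ≤ 146` and
`‖𝔤′_{jμ}(L)‖ ≤ 449a`. [cite: Zhang2022LandauSiegel, §8 Lemma 8.4] -/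
theorem norm_frakg_le {β1 β2 βμ : ℂ} {a L : ℝ} (ha : 0 < a) (hμre : βμ.re = 0)
    (hμ : ‖βμ‖ ≤ 3 * a) (hμ' : 3 * a / 2 ≤ ‖βμ‖) (h1 : ‖β1‖ ≤ 4 * a) (h2 : ‖β2‖ ≤ 4 * a)
    (hL : a * |L| ≤ 4) :
    ‖frakg β1 β2 βμ L‖ ≤ 146 ∧
      ‖cexp (-(βμ * L)) * (-((β1 - βμ) * (β2 - βμ) / βμ) -
        (1 - β1 * β2 / βμ ^ 2 - (β1 - βμ) * (β2 - βμ) / βμ * L) * βμ)‖ ≤ 449 * a := by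
  have hμ0 : 0 < ‖βμ‖ := lt_of_lt_of_le (by positivity) hμ'
  have hL' : ‖(L : ℂ)‖ = |L| := by rw [Complex.norm_real, Real.norm_eq_abs]
  -- `‖A‖ ≤ 64/9`
  have hA : ‖β1 * β2 / βμ ^ 2‖ ≤ 64 / 9 := by
    rw [norm_div, norm_mul, norm_pow, div_le_iff₀ (by positivity)]
    have : ‖β1‖ * ‖β2‖ ≤ (4 * a) * (4 * a) := mul_le_mul h1 h2 (norm_nonneg _) (by positivity)
    nlinarith [this, hμ', norm_nonneg β1, norm_nonneg β2]
  -- `‖E‖ ≤ 98a/3`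
  have hE : ‖(β1 - βμ) * (β2 - βμ) / βμ‖ ≤ 98 * a / 3 := by
    have e1 : ‖β1 - βμ‖ ≤ 7 * a := (norm_sub_le _ _).trans (by linarith)
    have e2 : ‖β2 - βμ‖ ≤ 7 * a := (norm_sub_le _ _).trans (by linarith)
    rw [norm_div, norm_mul, div_le_iff₀ hμ0]
    have : ‖β1 - βμ‖ * ‖β2 - βμ‖ ≤ (7 * a) * (7 * a) := mul_le_mul e1 e2 (norm_nonneg _) (by positivity)
    nlinarith [this, hμ', norm_nonneg (β1 - βμ), norm_nonneg (β2 - βμ)]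
  have hB : ‖1 - β1 * β2 / βμ ^ 2‖ ≤ 73 / 9 := by
    calc ‖1 - β1 * β2 / βμ ^ 2‖ ≤ ‖(1 : ℂ)‖ + ‖β1 * β2 / βμ ^ 2‖ := norm_sub_le _ _
      _ ≤ 1 + 64 / 9 := by rw [norm_one]; gcongr
      _ = 73 / 9 := by norm_num
  have hEL : ‖(β1 - βμ) * (β2 - βμ) / βμ * (L : ℂ)‖ ≤ 392 / 3 := by
    rw [norm_mul, hL']
    calc ‖(β1 - βμ) * (β2 - βμ) / βμ‖ * |L| ≤ 98 * a / 3 * |L| := by gcongr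
      _ = 98 / 3 * (a * |L|) := by ring
      _ ≤ 98 / 3 * 4 := by gcongr
      _ = 392 / 3 := by norm_num
  have hmid : ‖1 - β1 * β2 / βμ ^ 2 - (β1 - βμ) * (β2 - βμ) / βμ * (L : ℂ)‖ ≤ 73 / 9 + 392 / 3 :=
    (norm_sub_le _ _).trans (add_le_add hB hEL)
  refine ⟨?_, ?_⟩
  · rw [frakg]
    calc ‖β1 * β2 / βμ ^ 2 + (1 - β1 * β2 / βμ ^ 2 - (β1 - βμ) * (β2 - βμ) / βμ * (L : ℂ)) *
          cexp (-(βμ * L))‖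
        ≤ ‖β1 * β2 / βμ ^ 2‖ + ‖(1 - β1 * β2 / βμ ^ 2 - (β1 - βμ) * (β2 - βμ) / βμ * (L : ℂ)) *
          cexp (-(βμ * L))‖ := norm_add_le _ _
      _ = ‖β1 * β2 / βμ ^ 2‖ +
          ‖1 - β1 * β2 / βμ ^ 2 - (β1 - βμ) * (β2 - βμ) / βμ * (L : ℂ)‖ := by
          rw [norm_mul, norm_cexp_neg_mul_ofReal_of_re_eq_zero hμre, mul_one]
      _ ≤ 64 / 9 + (73 / 9 + 392 / 3) := add_le_add hA hmid
      _ ≤ 146 := by norm_num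
  · rw [norm_mul, norm_cexp_neg_mul_ofReal_of_re_eq_zero hμre, one_mul]
    calc ‖-((β1 - βμ) * (β2 - βμ) / βμ) -
          (1 - β1 * β2 / βμ ^ 2 - (β1 - βμ) * (β2 - βμ) / βμ * (L : ℂ)) * βμ‖
        ≤ ‖-((β1 - βμ) * (β2 - βμ) / βμ)‖ +
          ‖(1 - β1 * β2 / βμ ^ 2 - (β1 - βμ) * (β2 - βμ) / βμ * (L : ℂ)) * βμ‖ := norm_sub_le _ _
      _ = ‖(β1 - βμ) * (β2 - βμ) / βμ‖ +
          ‖1 - β1 * β2 / βμ ^ 2 - (β1 - βμ) * (β2 - βμ) / βμ * (L : ℂ)‖ * ‖βμ‖ := by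
          rw [norm_neg, norm_mul]
      _ ≤ 98 * a / 3 + (73 / 9 + 392 / 3) * (3 * a) := by gcongr
      _ ≤ 449 * a := by nlinarith

/-! ### The profiles as functions of `t` through `L = log(Q/t)` -/

/-- `d/dt log(Q/t) = −1/t` (`Q, t > 0`), as a `ℂ`-valued function. [cite: Zhang2022LandauSiegel, §8 (8.11) p.48] -/
theorem hasDerivAt_ofReal_log_div {Q t : ℝ} (hQ : 0 < Q) (ht : 0 < t) :
    HasDerivAt (fun t : ℝ => ((Real.log (Q / t) : ℝ) : ℂ)) (-((t : ℂ)⁻¹)) t := by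
  have h1 : HasDerivAt (fun y : ℝ => Q * y⁻¹) (Q * -(t ^ 2)⁻¹) t := (hasDerivAt_inv ht.ne').const_mul Q
  have h2 : HasDerivAt (fun y : ℝ => Real.log (Q * y⁻¹)) (Q * -(t ^ 2)⁻¹ / (Q * t⁻¹)) t :=
    h1.log (by positivity)
  have h3 : HasDerivAt (fun y : ℝ => Real.log (Q / y)) (-(t⁻¹)) t := by
    have e : (fun y : ℝ => Real.log (Q / y)) = fun y => Real.log (Q * y⁻¹) := by
      funext y; rw [div_eq_mul_inv]
    rw [e]
    refine h2.congr_deriv ?_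
    field_simp
  have h4 := h3.ofReal_comp
  refine h4.congr_deriv ?_
  push_cast
  ring

/-- Chain rule: `d/dt g(log(Q/t)) = −g′(log(Q/t))/t` for `g` differentiable on `ℂ` (`Q, t > 0`).
[cite: Zhang2022LandauSiegel, §8 (8.11) p.48] -/
theorem hasDerivAt_comp_log_div {g : ℂ → ℂ} {g' : ℂ → ℂ} (hg : ∀ L : ℂ, HasDerivAt g (g' L) L)
    {Q t : ℝ} (hQ : 0 < Q) (ht : 0 < t) :
    HasDerivAt (fun t : ℝ => g ((Real.log (Q / t) : ℝ) : ℂ))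
      (-(g' ((Real.log (Q / t) : ℝ) : ℂ)) * (t : ℂ)⁻¹) t := by
  have h := HasDerivAt.comp t (hg ((Real.log (Q / t) : ℝ) : ℂ)) (hasDerivAt_ofReal_log_div hQ ht)
  refine h.congr_deriv ?_
  ring

/-- `|log(Q/t)| ≤ log T` for `Q, t ∈ [1, T]`. [cite: Zhang2022LandauSiegel, §8 (8.11) p.48] -/
theorem abs_log_div_le {Q t T : ℝ} (hQ1 : 1 ≤ Q) (hQT : Q ≤ T) (ht1 : 1 ≤ t) (htT : t ≤ T) :
    |Real.log (Q / t)| ≤ Real.log T := by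
  have hQ : 0 < Q := by linarith
  have ht : 0 < t := by linarith
  have hT : 0 < T := by linarith
  rw [abs_le, Real.log_div hQ.ne' ht.ne']
  have h1 : Real.log Q ≤ Real.log T := Real.log_le_log hQ hQT
  have h2 : Real.log t ≤ Real.log T := Real.log_le_log ht htT
  have h3 : 0 ≤ Real.log Q := Real.log_nonneg hQ1
  have h4 : 0 ≤ Real.log t := Real.log_nonneg ht1
  constructor <;> linarith

/-! ### The shifts for large `D`: `‖β_j‖ ≤ 4α`, `β_μ ∈ iℝ`, `3α/2 ≤ ‖β_μ‖ ≤ 3α` -/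

/-- `‖β_j‖ ≤ 4α` (`j` arbitrary; `β_j ∈ {β₁, β₂, β₃}` of (2.13)) once `5|c′|α𝓛 ≤ 1` and `α ≥ 0`.
[cite: Zhang2022LandauSiegel, §2 (2.13)] -/
theorem norm_betaJ_le (c' : ℝ) {D : ℕ} (hα : 0 ≤ alpha D) (hℓ : 0 ≤ ell D)
    (hc : 5 * |c'| * alpha D * ell D ≤ 1) (j : ℕ) :
    ‖betaJ c' D j‖ ≤ 4 * alpha D := by
  have hw : |c'| * alpha D * ell D ≤ 1 / 5 := by linarith
  have hw0 : 0 ≤ |c'| * alpha D * ell D := by positivity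
  have hprod : |c' * alpha D * ell D| = |c'| * alpha D * ell D := by
    rw [abs_mul, abs_mul, abs_of_nonneg hα, abs_of_nonneg hℓ]
  have n1 : ‖beta1 c' D‖ ≤ 4 * alpha D := by
    have e : beta1 c' D = (((alpha D) * (1 - 5 * c' * alpha D * ell D) : ℝ) : ℂ) * I := by
      unfold beta1; push_cast; ring
    rw [e, norm_mul, Complex.norm_I, mul_one, Complex.norm_real, Real.norm_eq_abs, abs_mul,
      abs_of_nonneg hα]
    have : |1 - 5 * c' * alpha D * ell D| ≤ 2 := by
      have h5 : |5 * c' * alpha D * ell D| = 5 * (|c'| * alpha D * ell D) := by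
        rw [show 5 * c' * alpha D * ell D = 5 * (c' * alpha D * ell D) by ring, abs_mul, hprod]
        norm_num
      calc |1 - 5 * c' * alpha D * ell D| ≤ |(1 : ℝ)| + |5 * c' * alpha D * ell D| := abs_sub _ _
        _ ≤ 1 + 5 * (1 / 5) := by rw [abs_one, h5]; gcongr
        _ = 2 := by norm_num
    nlinarith
  have n2 : ‖beta2 c' D‖ ≤ 4 * alpha D := by
    have e : beta2 c' D = ((2 * (alpha D) * (1 + c' * alpha D * ell D) : ℝ) : ℂ) * I := by
      unfold beta2; push_cast; ring
    rw [e, norm_mul, Complex.norm_I, mul_one, Complex.norm_real, Real.norm_eq_abs, abs_mul, abs_mul,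
      abs_of_nonneg hα, abs_two]
    have : |1 + c' * alpha D * ell D| ≤ 2 := by
      calc |1 + c' * alpha D * ell D| ≤ |(1 : ℝ)| + |c' * alpha D * ell D| := abs_add_le _ _
        _ ≤ 1 + 1 / 5 := by rw [abs_one, hprod]; gcongr
        _ ≤ 2 := by norm_num
    nlinarith
  have n3 : ‖beta3 c' D‖ ≤ 4 * alpha D := by
    have e : beta3 c' D = ((3 * (alpha D) * (1 - c' * alpha D * ell D) : ℝ) : ℂ) * I := by
      unfold beta3; push_cast; ring
    rw [e, norm_mul, Complex.norm_I, mul_one, Complex.norm_real, Real.norm_eq_abs, abs_mul, abs_mul,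
      abs_of_nonneg hα, show |(3 : ℝ)| = 3 by norm_num]
    have : |1 - c' * alpha D * ell D| ≤ 4 / 3 := by
      calc |1 - c' * alpha D * ell D| ≤ |(1 : ℝ)| + |c' * alpha D * ell D| := abs_sub _ _
        _ ≤ 1 + 1 / 5 := by rw [abs_one, hprod]; gcongr
        _ ≤ 4 / 3 := by norm_num
    nlinarith
  unfold betaJ
  split_ifs
  · exact n1
  · exact n2
  · exact n3

/-- `β_μ` (`μ = 6, 7`: `3iα/2`, `5iα/2`; (2.22)) is purely imaginary. [cite: Zhang2022LandauSiegel, §2 (2.22)] -/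
theorem betaMu_re (D μ : ℕ) : (betaMu D μ).re = 0 := by
  unfold betaMu beta6 beta7
  split_ifs <;> simp

/-- `3α/2 ≤ ‖β_μ‖ ≤ 3α` (`α ≥ 0`). [cite: Zhang2022LandauSiegel, §2 (2.22)] -/
theorem norm_betaMu_bounds {D : ℕ} (hα : 0 ≤ alpha D) (μ : ℕ) :
    3 * alpha D / 2 ≤ ‖betaMu D μ‖ ∧ ‖betaMu D μ‖ ≤ 3 * alpha D := by
  unfold betaMu beta6 beta7
  split_ifs
  · have e : 5 * I * (alpha D : ℂ) / 2 = ((5 * alpha D / 2 : ℝ) : ℂ) * I := by push_cast; ring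
    rw [e, norm_mul, Complex.norm_I, mul_one, Complex.norm_real, Real.norm_eq_abs,
      abs_of_nonneg (by positivity)]
    constructor <;> linarith
  · have e : 3 * I * (alpha D : ℂ) / 2 = ((3 * alpha D / 2 : ℝ) : ℂ) * I := by push_cast; ring
    rw [e, norm_mul, Complex.norm_I, mul_one, Complex.norm_real, Real.norm_eq_abs,
      abs_of_nonneg (by positivity)]
    constructor <;> linarith

/-! ### The profiles `𝓕_{jμ}(Q/t)`, `𝓖_{jμ}(Q/t)` and the factors of (8.11) as functions of `t` -/

section TProfiles

variable (c' : ℝ) {D : ℕ}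

/-- **`t ↦ 𝓕_{jμ}(Q/t)` on `[1, T]`**: differentiable, `‖𝓕_{jμ}(Q/t)‖ ≤ 29`,
`‖(d/dt)𝓕_{jμ}(Q/t)‖ ≤ 94α/t`, provided `Q ∈ [1, T]`, `α log T ≤ 4` and `5|c′|α𝓛 ≤ 1` (so that
`‖β_j‖ ≤ 4α`). [cite: Zhang2022LandauSiegel, §8 Lemma 8.2, (8.11) p.48] -/
theorem frakfW_div_bounds (j μ : ℕ) {Q T t : ℝ} (hα : 0 < alpha D) (hℓ : 0 ≤ ell D)
    (hc : 5 * |c'| * alpha D * ell D ≤ 1) (hQ1 : 1 ≤ Q) (hQT : Q ≤ T) (ht1 : 1 ≤ t) (htT : t ≤ T)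
    (hT : alpha D * Real.log T ≤ 4) :
    DifferentiableAt ℝ (fun u : ℝ => frakfW c' D j μ (Q / u)) t ∧
      ‖frakfW c' D j μ (Q / t)‖ ≤ 29 ∧
      ‖deriv (fun u : ℝ => frakfW c' D j μ (Q / u)) t‖ ≤ 94 * alpha D / t := by
  have hQ : 0 < Q := by linarith
  have ht : 0 < t := by linarith
  set βj := betaJ c' D j with hβj
  set βμ := betaMu D μ with hβμ
  have hd : HasDerivAt (fun u : ℝ => frakfW c' D j μ (Q / u))
      (-(cexp (βμ * ((Real.log (Q / t) : ℝ) : ℂ)) * ((βμ - βj) +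
        (1 + (βμ - βj) * ((Real.log (Q / t) : ℝ) : ℂ)) * βμ)) * (t : ℂ)⁻¹) t :=
    hasDerivAt_comp_log_div (hasDerivAt_frakf βj βμ) hQ ht
  have hLbd : alpha D * |Real.log (Q / t)| ≤ 4 :=
    (mul_le_mul_of_nonneg_left (abs_log_div_le hQ1 hQT ht1 htT) hα.le).trans hT
  have hb := norm_frakf_le (L := Real.log (Q / t)) (betaMu_re D μ) (norm_betaMu_bounds hα.le μ).2
    (norm_betaJ_le c' hα.le hℓ hc j) hLbd
  refine ⟨hd.differentiableAt, hb.1, ?_⟩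
  rw [hd.deriv, norm_mul, norm_neg, norm_inv, Complex.norm_real, Real.norm_eq_abs, abs_of_pos ht,
    ← div_eq_mul_inv]
  exact div_le_div_of_nonneg_right hb.2 ht.le

/-- **`t ↦ 𝓖_{jμ}(Q/t)` on `[1, T]`**: differentiable, `‖𝓖_{jμ}(Q/t)‖ ≤ 146`,
`‖(d/dt)𝓖_{jμ}(Q/t)‖ ≤ 449α/t` (same provisos). [cite: Zhang2022LandauSiegel, §8 Lemma 8.4, (8.11) p.48] -/
theorem frakgW_div_bounds (j μ : ℕ) {Q T t : ℝ} (hα : 0 < alpha D) (hℓ : 0 ≤ ell D)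
    (hc : 5 * |c'| * alpha D * ell D ≤ 1) (hQ1 : 1 ≤ Q) (hQT : Q ≤ T) (ht1 : 1 ≤ t) (htT : t ≤ T)
    (hT : alpha D * Real.log T ≤ 4) :
    DifferentiableAt ℝ (fun u : ℝ => frakgW c' D j μ (Q / u)) t ∧
      ‖frakgW c' D j μ (Q / t)‖ ≤ 146 ∧
      ‖deriv (fun u : ℝ => frakgW c' D j μ (Q / u)) t‖ ≤ 449 * alpha D / t := by
  have hQ : 0 < Q := by linarith
  have ht : 0 < t := by linarith
  set β1 := betaJ c' D (j + 1) with hβ1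
  set β2 := betaJ c' D (j + 2) with hβ2
  set βμ := betaMu D μ with hβμ
  have hd : HasDerivAt (fun u : ℝ => frakgW c' D j μ (Q / u))
      (-(cexp (-(βμ * ((Real.log (Q / t) : ℝ) : ℂ))) * (-((β1 - βμ) * (β2 - βμ) / βμ) -
        (1 - β1 * β2 / βμ ^ 2 - (β1 - βμ) * (β2 - βμ) / βμ * ((Real.log (Q / t) : ℝ) : ℂ)) * βμ)) *
        (t : ℂ)⁻¹) t :=
    hasDerivAt_comp_log_div (hasDerivAt_frakg β1 β2 βμ) hQ ht
  have hLbd : alpha D * |Real.log (Q / t)| ≤ 4 :=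
    (mul_le_mul_of_nonneg_left (abs_log_div_le hQ1 hQT ht1 htT) hα.le).trans hT
  have hμb := norm_betaMu_bounds hα.le μ
  have hb := norm_frakg_le (L := Real.log (Q / t)) hα (betaMu_re D μ) hμb.2 hμb.1
    (norm_betaJ_le c' hα.le hℓ hc (j + 1)) (norm_betaJ_le c' hα.le hℓ hc (j + 2)) hLbd
  refine ⟨hd.differentiableAt, hb.1, ?_⟩
  rw [hd.deriv, norm_mul, norm_neg, norm_inv, Complex.norm_real, Real.norm_eq_abs, abs_of_pos ht,
    ← div_eq_mul_inv]
  exact div_le_div_of_nonneg_right hb.2 ht.le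

/-- Product rule with `O(1)`, `O(1/t)` bounds. [cite: Zhang2022LandauSiegel, §8 (8.11) p.48] -/
theorem mul_bounds {f g : ℝ → ℂ} {t A B A' B' : ℝ} (hf : DifferentiableAt ℝ f t)
    (hg : DifferentiableAt ℝ g t) (nf : ‖f t‖ ≤ A) (ng : ‖g t‖ ≤ B) (nf' : ‖deriv f t‖ ≤ A' / t)
    (ng' : ‖deriv g t‖ ≤ B' / t) (hA : 0 ≤ A) :
    DifferentiableAt ℝ (fun u => f u * g u) t ∧ ‖f t * g t‖ ≤ A * B ∧
      ‖deriv (fun u => f u * g u) t‖ ≤ (A' * B + A * B') / t := by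
  have hB : 0 ≤ B := (norm_nonneg _).trans ng
  refine ⟨hf.mul hg, ?_, ?_⟩
  · rw [norm_mul]; exact mul_le_mul nf ng (norm_nonneg _) hA
  · have efg : (fun u => f u * g u) = f * g := rfl
    rw [efg, (hf.hasDerivAt.mul hg.hasDerivAt).deriv]
    calc ‖deriv f t * g t + f t * deriv g t‖ ≤ ‖deriv f t‖ * ‖g t‖ + ‖f t‖ * ‖deriv g t‖ := by
          refine (norm_add_le _ _).trans ?_; rw [norm_mul, norm_mul]
      _ ≤ A' / t * B + A * (B' / t) :=
          add_le_add (mul_le_mul nf' ng (norm_nonneg _) ((norm_nonneg _).trans nf'))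
            (mul_le_mul nf ng' (norm_nonneg _) hA)
      _ = (A' * B + A * B') / t := by ring

/-- **The `m`-factor `mFac` of (8.11) on `[1, T]`** (`P₁, P₂ ∈ [1, T]`, `α log T ≤ 4`): differentiable,
`‖mFac(t)‖ ≤ 29κ`, `‖mFac′(t)‖ ≤ 94ακ/t`, `κ = 1/log P₁ + ‖ι₂‖/log P₂`.
[cite: Zhang2022LandauSiegel, §8 (8.11) p.48, tex L2467] -/
theorem mFac_bounds (j : ℕ) {T t : ℝ} (hα : 0 < alpha D) (hℓ : 0 ≤ ell D)
    (hc : 5 * |c'| * alpha D * ell D ≤ 1) (hP1 : 1 ≤ Skeleton.P1 D) (hP2 : 1 ≤ Skeleton.P2 D)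
    (hP1T : Skeleton.P1 D ≤ T) (hP2T : Skeleton.P2 D ≤ T) (ht1 : 1 ≤ t) (htT : t ≤ T)
    (hT : alpha D * Real.log T ≤ 4) (hL1 : 0 < Real.log (Skeleton.P1 D))
    (hL2 : 0 < Real.log (Skeleton.P2 D)) :
    DifferentiableAt ℝ (mFac c' D j) t ∧
      ‖mFac c' D j t‖ ≤ 29 * (1 / Real.log (Skeleton.P1 D) + ‖iota2‖ / Real.log (Skeleton.P2 D)) ∧
      ‖deriv (mFac c' D j) t‖ ≤
        94 * alpha D * (1 / Real.log (Skeleton.P1 D) + ‖iota2‖ / Real.log (Skeleton.P2 D)) / t := by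
  have ht : 0 < t := by linarith
  obtain ⟨d6, n6, n6'⟩ := frakfW_div_bounds c' j 6 hα hℓ hc hP1 hP1T ht1 htT hT
  obtain ⟨d7, n7, n7'⟩ := frakfW_div_bounds c' j 7 hα hℓ hc hP2 hP2T ht1 htT hT
  set L1 : ℝ := Real.log (Skeleton.P1 D) with hL1def
  set L2 : ℝ := Real.log (Skeleton.P2 D) with hL2def
  have hL1C : ‖(L1 : ℂ)‖ = L1 := Complex.norm_of_nonneg hL1.le
  have hL2C : ‖(L2 : ℂ)‖ = L2 := Complex.norm_of_nonneg hL2.le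
  have e : mFac c' D j = fun u => frakfW c' D j 6 (Skeleton.P1 D / u) / (L1 : ℂ) +
      iota2 * frakfW c' D j 7 (Skeleton.P2 D / u) / (L2 : ℂ) := by
    funext u; rfl
  have hd : HasDerivAt (mFac c' D j)
      (deriv (fun u : ℝ => frakfW c' D j 6 (Skeleton.P1 D / u)) t / (L1 : ℂ) +
        iota2 * deriv (fun u : ℝ => frakfW c' D j 7 (Skeleton.P2 D / u)) t / (L2 : ℂ)) t := by
    rw [e]
    exact (d6.hasDerivAt.div_const _).add ((d7.hasDerivAt.const_mul iota2).div_const _)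
  refine ⟨hd.differentiableAt, ?_, ?_⟩
  · rw [e]
    calc ‖frakfW c' D j 6 (Skeleton.P1 D / t) / (L1 : ℂ) + iota2 * frakfW c' D j 7 (Skeleton.P2 D / t) / (L2 : ℂ)‖
        ≤ ‖frakfW c' D j 6 (Skeleton.P1 D / t) / (L1 : ℂ)‖ + ‖iota2 * frakfW c' D j 7 (Skeleton.P2 D / t) / (L2 : ℂ)‖ :=
          norm_add_le _ _
      _ = ‖frakfW c' D j 6 (Skeleton.P1 D / t)‖ / L1 + ‖iota2‖ * ‖frakfW c' D j 7 (Skeleton.P2 D / t)‖ / L2 := by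
          rw [norm_div, norm_div, norm_mul, hL1C, hL2C]
      _ ≤ 29 / L1 + ‖iota2‖ * 29 / L2 := by gcongr
      _ = 29 * (1 / L1 + ‖iota2‖ / L2) := by ring
  · rw [hd.deriv]
    calc ‖deriv (fun u : ℝ => frakfW c' D j 6 (Skeleton.P1 D / u)) t / (L1 : ℂ) +
          iota2 * deriv (fun u : ℝ => frakfW c' D j 7 (Skeleton.P2 D / u)) t / (L2 : ℂ)‖
        ≤ ‖deriv (fun u : ℝ => frakfW c' D j 6 (Skeleton.P1 D / u)) t / (L1 : ℂ)‖ +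
          ‖iota2 * deriv (fun u : ℝ => frakfW c' D j 7 (Skeleton.P2 D / u)) t / (L2 : ℂ)‖ :=
          norm_add_le _ _
      _ = ‖deriv (fun u : ℝ => frakfW c' D j 6 (Skeleton.P1 D / u)) t‖ / L1 +
          ‖iota2‖ * ‖deriv (fun u : ℝ => frakfW c' D j 7 (Skeleton.P2 D / u)) t‖ / L2 := by
          rw [norm_div, norm_div, norm_mul, hL1C, hL2C]
      _ ≤ (94 * alpha D / t) / L1 + ‖iota2‖ * (94 * alpha D / t) / L2 := by gcongr
      _ = 94 * alpha D * (1 / L1 + ‖iota2‖ / L2) / t := by ring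

/-- **The `n`-factor `nFac` of (8.11) on `[1, T]`**: differentiable, `‖nFac(t)‖ ≤ 146κ`,
`‖nFac′(t)‖ ≤ 449ακ/t`. [cite: Zhang2022LandauSiegel, §8 (8.11) p.48, tex L2467] -/
theorem nFac_bounds (j : ℕ) {T t : ℝ} (hα : 0 < alpha D) (hℓ : 0 ≤ ell D)
    (hc : 5 * |c'| * alpha D * ell D ≤ 1) (hP1 : 1 ≤ Skeleton.P1 D) (hP2 : 1 ≤ Skeleton.P2 D)
    (hP1T : Skeleton.P1 D ≤ T) (hP2T : Skeleton.P2 D ≤ T) (ht1 : 1 ≤ t) (htT : t ≤ T)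
    (hT : alpha D * Real.log T ≤ 4) (hL1 : 0 < Real.log (Skeleton.P1 D))
    (hL2 : 0 < Real.log (Skeleton.P2 D)) :
    DifferentiableAt ℝ (nFac c' D j) t ∧
      ‖nFac c' D j t‖ ≤ 146 * (1 / Real.log (Skeleton.P1 D) + ‖iota2‖ / Real.log (Skeleton.P2 D)) ∧
      ‖deriv (nFac c' D j) t‖ ≤
        449 * alpha D * (1 / Real.log (Skeleton.P1 D) + ‖iota2‖ / Real.log (Skeleton.P2 D)) / t := by
  have ht : 0 < t := by linarith
  obtain ⟨d6, n6, n6'⟩ := frakgW_div_bounds c' j 6 hα hℓ hc hP1 hP1T ht1 htT hT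
  obtain ⟨d7, n7, n7'⟩ := frakgW_div_bounds c' j 7 hα hℓ hc hP2 hP2T ht1 htT hT
  set L1 : ℝ := Real.log (Skeleton.P1 D) with hL1def
  set L2 : ℝ := Real.log (Skeleton.P2 D) with hL2def
  have hL1C : ‖(L1 : ℂ)‖ = L1 := Complex.norm_of_nonneg hL1.le
  have hL2C : ‖(L2 : ℂ)‖ = L2 := Complex.norm_of_nonneg hL2.le
  have hι : ‖conj iota2‖ = ‖iota2‖ := Complex.norm_conj _
  have e : nFac c' D j = fun u => frakgW c' D j 6 (Skeleton.P1 D / u) / (L1 : ℂ) +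
      conj iota2 * frakgW c' D j 7 (Skeleton.P2 D / u) / (L2 : ℂ) := by
    funext u; rfl
  have hd : HasDerivAt (nFac c' D j)
      (deriv (fun u : ℝ => frakgW c' D j 6 (Skeleton.P1 D / u)) t / (L1 : ℂ) +
        conj iota2 * deriv (fun u : ℝ => frakgW c' D j 7 (Skeleton.P2 D / u)) t / (L2 : ℂ)) t := by
    rw [e]
    exact (d6.hasDerivAt.div_const _).add ((d7.hasDerivAt.const_mul (conj iota2)).div_const _)
  refine ⟨hd.differentiableAt, ?_, ?_⟩
  · rw [e]
    calc ‖frakgW c' D j 6 (Skeleton.P1 D / t) / (L1 : ℂ) + conj iota2 * frakgW c' D j 7 (Skeleton.P2 D / t) / (L2 : ℂ)‖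
        ≤ ‖frakgW c' D j 6 (Skeleton.P1 D / t) / (L1 : ℂ)‖ + ‖conj iota2 * frakgW c' D j 7 (Skeleton.P2 D / t) / (L2 : ℂ)‖ :=
          norm_add_le _ _
      _ = ‖frakgW c' D j 6 (Skeleton.P1 D / t)‖ / L1 + ‖iota2‖ * ‖frakgW c' D j 7 (Skeleton.P2 D / t)‖ / L2 := by
          rw [norm_div, norm_div, norm_mul, hL1C, hL2C, hι]
      _ ≤ 146 / L1 + ‖iota2‖ * 146 / L2 := by gcongr
      _ = 146 * (1 / L1 + ‖iota2‖ / L2) := by ring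
  · rw [hd.deriv]
    calc ‖deriv (fun u : ℝ => frakgW c' D j 6 (Skeleton.P1 D / u)) t / (L1 : ℂ) +
          conj iota2 * deriv (fun u : ℝ => frakgW c' D j 7 (Skeleton.P2 D / u)) t / (L2 : ℂ)‖
        ≤ ‖deriv (fun u : ℝ => frakgW c' D j 6 (Skeleton.P1 D / u)) t / (L1 : ℂ)‖ +
          ‖conj iota2 * deriv (fun u : ℝ => frakgW c' D j 7 (Skeleton.P2 D / u)) t / (L2 : ℂ)‖ :=
          norm_add_le _ _
      _ = ‖deriv (fun u : ℝ => frakgW c' D j 6 (Skeleton.P1 D / u)) t‖ / L1 +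
          ‖iota2‖ * ‖deriv (fun u : ℝ => frakgW c' D j 7 (Skeleton.P2 D / u)) t‖ / L2 := by
          rw [norm_div, norm_div, norm_mul, hL1C, hL2C, hι]
      _ ≤ (449 * alpha D / t) / L1 + ‖iota2‖ * (449 * alpha D / t) / L2 := by gcongr
      _ = 449 * alpha D * (1 / L1 + ‖iota2‖ / L2) / t := by ring

/-- **The diagonal factor `diagFac` of (8.11) on `[1, T]`**: differentiable,
`‖diagFac(t)‖ ≤ 4234/(log P₁)²`, `‖diagFac′(t)‖ ≤ 26745α/((log P₁)²t)`.
[cite: Zhang2022LandauSiegel, §8 (8.11) p.48, tex L2467] -/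
theorem diagFac_bounds (j : ℕ) {T t : ℝ} (hα : 0 < alpha D) (hℓ : 0 ≤ ell D)
    (hc : 5 * |c'| * alpha D * ell D ≤ 1) (hP1 : 1 ≤ Skeleton.P1 D) (hP1T : Skeleton.P1 D ≤ T)
    (ht1 : 1 ≤ t) (htT : t ≤ T) (hT : alpha D * Real.log T ≤ 4)
    (hL1 : 0 < Real.log (Skeleton.P1 D)) :
    DifferentiableAt ℝ (diagFac c' D j) t ∧
      ‖diagFac c' D j t‖ ≤ 4234 / Real.log (Skeleton.P1 D) ^ 2 ∧
      ‖deriv (diagFac c' D j) t‖ ≤ 26745 * alpha D / Real.log (Skeleton.P1 D) ^ 2 / t := by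
  have ht : 0 < t := by linarith
  obtain ⟨df, nf, nf'⟩ := frakfW_div_bounds c' j 6 hα hℓ hc hP1 hP1T ht1 htT hT
  obtain ⟨dg, ng, ng'⟩ := frakgW_div_bounds c' j 6 hα hℓ hc hP1 hP1T ht1 htT hT
  obtain ⟨dp, np, np'⟩ := mul_bounds df dg nf ng nf' ng' (by norm_num)
  set L1 : ℝ := Real.log (Skeleton.P1 D) with hL1def
  have hL1C : ‖(L1 : ℂ) ^ 2‖ = L1 ^ 2 := by rw [norm_pow, Complex.norm_of_nonneg hL1.le]
  have e : diagFac c' D j = fun u => frakfW c' D j 6 (Skeleton.P1 D / u) *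
      frakgW c' D j 6 (Skeleton.P1 D / u) / (L1 : ℂ) ^ 2 := by
    funext u; rfl
  refine ⟨?_, ?_, ?_⟩
  · rw [e]; exact dp.div_const _
  · rw [e]
    show ‖frakfW c' D j 6 (Skeleton.P1 D / t) * frakgW c' D j 6 (Skeleton.P1 D / t) / (L1 : ℂ) ^ 2‖ ≤ _
    rw [norm_div, hL1C]
    exact div_le_div_of_nonneg_right (np.trans (by norm_num)) (by positivity)
  · rw [e, deriv_div_const, norm_div, hL1C, div_div, mul_comm (L1 ^ 2) t, ← div_div]
    refine div_le_div_of_nonneg_right ?_ (by positivity)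
    refine np'.trans ?_
    rw [div_le_div_iff_of_pos_right ht]
    nlinarith [hα.le]

end TProfiles

end Literature.NumberTheory.LFunctions.Zhang2022.Section8AbelProfiles
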